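import Summits.Ventures.AbcSig.Rows.TemplateKraus
import Summits.Ventures.AbcSig.Recipes.EisPackage

/-!
# Venture AbcSig — discharge of a per-orbit exclusion by an EXPONENT-SPECIFIC (Kraus) trace table (cell module M4)

HONEST FRAMING. Glue file of a COMPUTATION cell (`pub-abcsig`); no Diophantine statement, no claim on ABC or any
summit. The cell's module M4 (Kraus's auxiliary-prime method, [Kra97]; [BS04, Prop. 4.3 + Lemma 4.2's proof]) closes a
residual exponent `n₀` of the trace sieve at an orbit by the congruences at auxiliary primes `q ≡ 1 (mod n₀)`, where the
possible traces `a_q(E) (mod n₀)` of the Frey curves of the family form a COMPUTED table smaller than Lemma 4.2's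
generic list. In Lean the table is DATA (`A : ℕ → List ℤ`, a generated `def`) whose correctness is the named hypothesis
`NewformModel.RefinedTraces fam A` of `Rows/TemplateKraus.lean` (CITED recipe + COMPUTED table, referee-cross-checked —
the convention of the cell's single-exponent rows `C7-n11 … n19`). THIS FILE proves the one lemma that lets an
all-exponents row use such a table at ONE residual exponent:

* `NewformModel.excludes_of_refinedTraces` — if every datum of `fam` has exponent `n₀`, `RefinedTraces fam A` holds,
  the extended orbit data `X` (same `F`, more eigenvalue entries — at the auxiliary primes, which lie beyond the sieve
  file's `ℓ ≤ 61`) refine the tree's sieve data `o` (`Refines N o X`, COMPUTED as in `Recipes/EisPackage.lean`), and a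
  kernel certificate gives `X.Eliminated A n₀`, then `M.Excludes N o fam` — exactly the hypothesis shape `hX_…` that the
  row templates take for that orbit, now PROVED from one table hypothesis per `(family, n₀)` instead of being cited per
  orbit.

References: A. Kraus, Canad. J. Math. 49 (1997) 1139–1161; [BS04] Bennett–Skinner, Canad. J. Math. 56 (2004), Prop. 4.3,
Lemma 4.2; cell records: module M4 certificates `census/rows/*/M4/M4p1_*.json` (p1) with engine-2's independent
implementation `engine/engine-2/results/M4/` (agreement recorded in the rows of record).
-/

namespace Summit.Ventures.AbcSig

/-- **Kraus-table discharge of a per-orbit exclusion.** See the module docstring. -/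
theorem NewformModel.excludes_of_refinedTraces (M : NewformModel) {N : ℕ} (o X : OrbitData) (hF : X.F = o.F)
    (hRef : M.Refines N o X) (fam : FreyDatum → Prop) (n₀ : ℕ) (A : ℕ → List ℤ) (hA : M.RefinedTraces fam A)
    (hfam : ∀ S, fam S → S.n = n₀) (helim : X.Eliminated A n₀)
    (hgood : ∀ e ∈ X.coeffs, e.ell.Prime ∧ e.ell ≠ 2 ∧ ¬ e.ell ∣ N) : M.Excludes N o fam := by
  intro S hS f hfo harises
  obtain ⟨θ, hFθ, hco⟩ := hfo
  have hX : M.Matches f X := ⟨θ, by rw [hF]; exact hFθ, hRef f θ hFθ hco⟩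
  have h := M.not_arisesMod_of_eliminated f X hX n₀ A helim hgood
  rw [← hfam S hS] at h
  exact h (hA S N f hS harises)

end Summit.Ventures.AbcSig
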